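import Summits.BirchSwinnertonDyer.BirchSwinnertonDyer.Theorems.AlignedTransportAtTwoOffStratumPartitionTwistFamilyZhaiTransportSeeds
import Summits.BirchSwinnertonDyer.BirchSwinnertonDyer.Theorems.TwoAdicConverseFrobeniusParityTwoDivisionRoot
import HarnessLib

/-!
# Route `AlignedTransportAtTwo`, crux C2 `MainConjectureOfRankZeroBSDAtTwo` (stmt-22298), line `birth` — THE `a_q`-ODD TWIST CLASSES OF `2045b1` (`N = 5·409`, off the Kilford stratum):
# MEMBERSHIP BY ONE `decide` and explicit prime-star members with `BSD(W, 2)` by print-transport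

HONEST FRAMING (cell `bsd-f1-sign2`, WIDTH-5 attach seat `bsd-line-att-p4` g25; `--supports stmt-BirchSwinnertonDyer-22298 --as helper`).
THEOREMS ONLY (no `def`, no named fact, no `sorry`). BSD is NOT proved; nothing is asserted — every row is CONDITIONAL on the displayed PRINT
named facts and the two displayed data of the seed (`Dt` optimality datum, `hL : ord₂ L(S,1)/Ω = 0`). Twin of att-p4 g24's `…TwistFamilyZhaiTransportMembers`
(`1727a1`, p752995) and of this seat's `…Members2071a1`: g24's successor item (d). The print-transport rows `bsdp_two_twist_oddTrace_<seed>` are g24's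
(`…ZhaiTransportSeeds`, p751625).

WHAT. Per seed `S`: `integralModelInt_b_S` (the `b`-invariants of Cremona's model), **`odd_frobeniusTrace_S_of_forall_ne_zero`** (`q` odd, `q ∤ N`, the
`2`-division cubic `4x³ + b₂x² + 2b₄x + b₆` has no root mod `q` ⟹ `a_q(S)` odd — tree dictionary `TwoAdicTwistConverse.odd_frobeniusTrace_iff_forall_ne_zero`), the
no-root certificates `forall_ne_zero_S_q` (`decide +kernel`), **`bsdp_two_twist_S_primeStar_of_forall_ne_zero`** (every globally minimal model `W` of `S^{(±q)}`,
`±q ≡ 1 (mod 4)`: `r_an = 0 ∧ rank 0 ∧ Ш[2^∞] = 0 ∧ c` odd `∧ BSD(W,2)` modulo PRINT⁷ + {`Dt`, `hL`}), and the members by `decide`: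
`2045b1^{(d)}` for `d = −3, 13, −19, −23, −31, −59, 73` (conductors `2045·d²` from `18 405` to `10 897 805`).

PARTITION CURRENCY (D-0171): unchanged (members of the (T) twist-family row of the rank-zero leaf, PRINT-TRANSPORT by p750624/p751625); the membership TEST
of `T_Z(S)` is now a kernel `decide` for every small seed of the cell. Beyond-print theorem: no. BSD is NOT proved.

References: [Zhai2016] Thm. 1.1; [MazurRubin2010] Lemma 2.10; [AbbesUllmo1996] Thm. A; [CreutzMiller2012] Thm. 1.1; [Miller2011LMS] Def. 1.1;
[CremonaAlgorithms1997] Table 1; [SilvermanAEC2009] III.2.3, V.2.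
-/

set_option autoImplicit false
set_option linter.dupNamespace false

noncomputable section

open scoped Classical

open WeierstrassCurve NumberField
open Literature.NumberTheory.EllipticCurves Literature.NumberTheory.EllipticCurves.ModularForms
open Literature.NumberTheory.EllipticCurves.Rank1Residual Literature.NumberTheory.EllipticCurves.Rank1Residual.Typed
open Literature.NumberTheory.EllipticCurves.CoatesLiTianZhai2015 Literature.NumberTheory.EllipticCurves.Zhai2016
open Summit.BirchSwinnertonDyer.Rank1Residual Summit.BirchSwinnertonDyer.Rank1Residual.X5
open Summit.BirchSwinnertonDyer.Uniform
open Summit.BirchSwinnertonDyer.BirchSwinnertonDyer.Theorems.TowerClass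
open Summit.BirchSwinnertonDyer.BirchSwinnertonDyer.Theorems.AlignedTransportAtTwoTwistFamilySmallSeeds
open Summit.BirchSwinnertonDyer.BirchSwinnertonDyer.Theorems.AlignedTransportAtTwoTwistFamilyZhaiTransport
open Summit.BirchSwinnertonDyer.BirchSwinnertonDyer.Theorems.AlignedTransportAtTwoTwistFamilyZhaiTransportSeeds
open Summit.BirchSwinnertonDyer.BirchSwinnertonDyer.Theorems

namespace Summit.BirchSwinnertonDyer.BirchSwinnertonDyer.Theorems.AlignedTransportAtTwoTwistFamilyZhaiTransportMembers2045b1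

/-! ## `2045b1` (`N = 2045`, model `[1, −1, 0, −5470, −862675]`): `a_q` odd from «no root of `4x³ − 3x² − 21880x − 3450700` mod `q`» -/

/-- The `b`-invariants of the integral model of `2045b1`: `b₂ = -3`, `b₄ = -10940`, `b₆ = -3450700`. [cite: CremonaAlgorithms1997, Table 1] -/
theorem integralModelInt_b_2045b1 : (integralModelInt c2045b1).b₂ = -3 ∧ (integralModelInt c2045b1).b₄ = -10940 ∧
    (integralModelInt c2045b1).b₆ = -3450700 := by
  have h : integralModelInt c2045b1 = M2045b1 := Instances.integralModelInt_baseChange_int M2045b1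
  rw [h]
  exact ⟨by decide, by decide, by decide⟩

/-- **`a_q(2045b1)` odd from one `decide`**: for an odd prime `q ∤ 2045`, if `4x³ − 3x² − 21880x − 3450700` has no root in `ℤ/q` then `a_q(2045b1)` is odd
(tree dictionary `TwoAdicTwistConverse.odd_frobeniusTrace_iff_forall_ne_zero`; good reduction at `q ∤ N = 2045`). [cite: SilvermanAEC2009, III.2.3 and V.2] -/
theorem odd_frobeniusTrace_2045b1_of_forall_ne_zero {q : ℕ} [Fact q.Prime] (hq2 : q ≠ 2) (hqN : ¬ q ∣ 2045)
    (hno : ∀ x : ZMod q, 4 * x ^ 3 - 3 * x ^ 2 - 21880 * x - 3450700 ≠ 0) : Odd (c2045b1.frobeniusTrace q) := by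
  have hgood : c2045b1.HasGoodReductionAtPrime q := by
    by_contra h
    exact hqN (by rw [← conductorNorm_2045b1]; exact (c2045b1.dvd_conductorNorm_iff_not_hasGoodReductionAtPrime q).mpr h)
  rw [TwoAdicTwistConverse.odd_frobeniusTrace_iff_forall_ne_zero c2045b1 q hq2 hgood, integralModelInt_b_2045b1.1,
    integralModelInt_b_2045b1.2.1, integralModelInt_b_2045b1.2.2]
  intro x
  have h := hno x
  push_cast
  intro h'
  apply h
  linear_combination h'

/-- No root of `4x³ − 3x² − 21880x − 3450700` mod `3` (so `a_{3}(2045b1)` is odd). [cite: CremonaAlgorithms1997, Table 1] -/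
theorem forall_ne_zero_2045b1_3 : ∀ x : ZMod 3, 4 * x ^ 3 - 3 * x ^ 2 - 21880 * x - 3450700 ≠ 0 := by decide +kernel

/-- No root of `4x³ − 3x² − 21880x − 3450700` mod `13` (so `a_{13}(2045b1)` is odd). [cite: CremonaAlgorithms1997, Table 1] -/
theorem forall_ne_zero_2045b1_13 : ∀ x : ZMod 13, 4 * x ^ 3 - 3 * x ^ 2 - 21880 * x - 3450700 ≠ 0 := by decide +kernel

/-- No root of `4x³ − 3x² − 21880x − 3450700` mod `19` (so `a_{19}(2045b1)` is odd). [cite: CremonaAlgorithms1997, Table 1] -/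
theorem forall_ne_zero_2045b1_19 : ∀ x : ZMod 19, 4 * x ^ 3 - 3 * x ^ 2 - 21880 * x - 3450700 ≠ 0 := by decide +kernel

/-- No root of `4x³ − 3x² − 21880x − 3450700` mod `23` (so `a_{23}(2045b1)` is odd). [cite: CremonaAlgorithms1997, Table 1] -/
theorem forall_ne_zero_2045b1_23 : ∀ x : ZMod 23, 4 * x ^ 3 - 3 * x ^ 2 - 21880 * x - 3450700 ≠ 0 := by decide +kernel

/-- No root of `4x³ − 3x² − 21880x − 3450700` mod `31` (so `a_{31}(2045b1)` is odd). [cite: CremonaAlgorithms1997, Table 1] -/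
theorem forall_ne_zero_2045b1_31 : ∀ x : ZMod 31, 4 * x ^ 3 - 3 * x ^ 2 - 21880 * x - 3450700 ≠ 0 := by decide +kernel

/-- No root of `4x³ − 3x² − 21880x − 3450700` mod `59` (so `a_{59}(2045b1)` is odd). [cite: CremonaAlgorithms1997, Table 1] -/
theorem forall_ne_zero_2045b1_59 : ∀ x : ZMod 59, 4 * x ^ 3 - 3 * x ^ 2 - 21880 * x - 3450700 ≠ 0 := by decide +kernel

/-- No root of `4x³ − 3x² − 21880x − 3450700` mod `73` (so `a_{73}(2045b1)` is odd). [cite: CremonaAlgorithms1997, Table 1] -/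
theorem forall_ne_zero_2045b1_73 : ∀ x : ZMod 73, 4 * x ^ 3 - 3 * x ^ 2 - 21880 * x - 3450700 ≠ 0 := by decide +kernel

section Members2045b1

variable (W : WeierstrassCurve ℚ) [W.IsElliptic] [W.IsGloballyMinimal]
  (h11 : thm11_ordTwo_LAlg_twist_eq_zero') (h12 : thm12_ordTwo_LAlg_twist_eq_one')
  (hMR' : MazurRubin2010.d2_eq_of_lemma210_rat) (hmod : exists_isNewformOf)
  (hAU : abbesUllmo_not_dvd_maninConstant_of_not_dvd_level)
  (hCM : bsdTriple_of_rank_le_one_of_conductor_lt) (hGZK : rank_eq_analyticRank_of_analyticRank_le_one)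

include h11 h12 hMR' hmod hAU hCM hGZK in
/-- **`BSD(W, 2)` by PRINT-TRANSPORT for every globally minimal model `W` of `2045b1^{(d)}`, `d = ±q` a prime-star** (`q` an odd prime, `q ∤ 2045`,
`d ∈ {q, −q}` with `d ≡ 1 (mod 4)`, and `4x³ − 3x² − 21880x − 3450700` without root mod `q` — i.e. `a_q(2045b1)` odd, one `decide`): `r_an(W) = 0 ∧ rank 0 ∧
Ш(W)[2^∞] = 0 ∧ c(W)` odd `∧ BSD(W, 2)`, modulo PRINT⁷ {Zhai 1.1′/1.2′, Mazur–Rubin L. 2.10, modularity, Abbes–Ullmo, Creutz–Miller, GZK} +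
displayed {`Dt`, `hL`} of `2045b1`. No Kato, no certificate. CONDITIONAL; BSD is NOT proved. [cite: Zhai2016, Thm. 1.1]
[cite: MazurRubin2010, Lemma 2.10] [cite: CreutzMiller2012, Thm. 1.1] [cite: AbbesUllmo1996, Thm. A] [cite: Miller2011LMS, Def. 1.1] -/
theorem bsdp_two_twist_2045b1_primeStar_of_forall_ne_zero [NeZero (c2045b1.conductorNorm ℤ)]
    (Dt : ModularParametrizationData c2045b1 (c2045b1.conductorNorm ℤ)) (hopt : Zhai2021.IsOptimalDatum c2045b1 Dt)
    (hL : ∃ x : ℚ, IsLAlg c2045b1 x ∧ x ≠ 0 ∧ padicValRat 2 x = 0)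
    {q : ℕ} [Fact q.Prime] (hq2 : q ≠ 2) (hqN : ¬ q ∣ 2045) (hno : ∀ x : ZMod q, 4 * x ^ 3 - 3 * x ^ 2 - 21880 * x - 3450700 ≠ 0)
    {d : ℤ} (hd : d = q ∨ d = -q) (hd4 : d % 4 = 1)
    {c : VariableChange ℚ} (hc : c • c2045b1.quadraticTwist (d : ℚ) = W) :
    W.analyticRank = 0 ∧ W.mordellWeilRank = 0 ∧ AddCommGroup.primaryComponent W.sha 2 = ⊥ ∧ Odd W.tamagawaProduct ∧ BSDp W 2 := by
  have hq : q.Prime := Fact.out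
  have hdabs : d.natAbs = q := by rcases hd with rfl | rfl <;> simp
  have hsqf : Squarefree d := by
    rw [← Int.squarefree_natAbs, hdabs]; exact hq.squarefree
  have hd1 : d ≠ 1 := by
    rintro rfl
    rw [Int.natAbs_one] at hdabs
    exact hq.one_lt.ne hdabs
  have hgcd : Int.gcd d 2045 = 1 := by
    rw [Int.gcd_eq_natAbs, hdabs]
    exact (Nat.Prime.coprime_iff_not_dvd hq).mpr hqN
  refine bsdp_two_twist_oddTrace_2045b1 W h11 h12 hMR' hmod hAU hCM hGZK Dt hopt hL hsqf hd1 hd4 hgcd (fun p hp hpd ↦ ?_) hc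
  have hpq : p = q := by
    have h1 : p ∣ d.natAbs := Int.natCast_dvd.mp hpd
    rw [hdabs] at h1
    exact (Nat.prime_dvd_prime_iff_eq hp hq).mp h1
  subst hpq
  exact odd_frobeniusTrace_2045b1_of_forall_ne_zero hq2 hqN hno

include h11 h12 hMR' hmod hAU hCM hGZK in
/-- **`BSD(W, 2)` by print-transport for every globally minimal model of `2045b1^{(-3)}`** (`N = 18 405`; no root mod `3`, `decide`). CONDITIONAL;
BSD is NOT proved. [cite: Zhai2016, Thm. 1.1] [cite: MazurRubin2010, Lemma 2.10] [cite: CreutzMiller2012, Thm. 1.1] [cite: Miller2011LMS, Def. 1.1] -/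
theorem bsdp_two_twist_2045b1_neg3 [NeZero (c2045b1.conductorNorm ℤ)]
    (Dt : ModularParametrizationData c2045b1 (c2045b1.conductorNorm ℤ)) (hopt : Zhai2021.IsOptimalDatum c2045b1 Dt)
    (hL : ∃ x : ℚ, IsLAlg c2045b1 x ∧ x ≠ 0 ∧ padicValRat 2 x = 0)
    {c : VariableChange ℚ} (hc : c • c2045b1.quadraticTwist ((-3 : ℤ) : ℚ) = W) : BSDp W 2 :=
  haveI : Fact (Nat.Prime 3) := ⟨by norm_num⟩
  (bsdp_two_twist_2045b1_primeStar_of_forall_ne_zero W h11 h12 hMR' hmod hAU hCM hGZK Dt hopt hL (q := 3) (by norm_num) (by norm_num)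
    forall_ne_zero_2045b1_3 (Or.inr (by norm_num)) (by decide) hc).2.2.2.2

include h11 h12 hMR' hmod hAU hCM hGZK in
/-- **`BSD(W, 2)` by print-transport for every globally minimal model of `2045b1^{(13)}`** (`N = 345 605`; no root mod `13`, `decide`). CONDITIONAL;
BSD is NOT proved. [cite: Zhai2016, Thm. 1.1] [cite: MazurRubin2010, Lemma 2.10] [cite: CreutzMiller2012, Thm. 1.1] [cite: Miller2011LMS, Def. 1.1] -/
theorem bsdp_two_twist_2045b1_13 [NeZero (c2045b1.conductorNorm ℤ)]
    (Dt : ModularParametrizationData c2045b1 (c2045b1.conductorNorm ℤ)) (hopt : Zhai2021.IsOptimalDatum c2045b1 Dt)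
    (hL : ∃ x : ℚ, IsLAlg c2045b1 x ∧ x ≠ 0 ∧ padicValRat 2 x = 0)
    {c : VariableChange ℚ} (hc : c • c2045b1.quadraticTwist ((13 : ℤ) : ℚ) = W) : BSDp W 2 :=
  haveI : Fact (Nat.Prime 13) := ⟨by norm_num⟩
  (bsdp_two_twist_2045b1_primeStar_of_forall_ne_zero W h11 h12 hMR' hmod hAU hCM hGZK Dt hopt hL (q := 13) (by norm_num) (by norm_num)
    forall_ne_zero_2045b1_13 (Or.inl (by norm_num)) (by decide) hc).2.2.2.2

include h11 h12 hMR' hmod hAU hCM hGZK in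
/-- **`BSD(W, 2)` by print-transport for every globally minimal model of `2045b1^{(-19)}`** (`N = 738 245`; no root mod `19`, `decide`). CONDITIONAL;
BSD is NOT proved. [cite: Zhai2016, Thm. 1.1] [cite: MazurRubin2010, Lemma 2.10] [cite: CreutzMiller2012, Thm. 1.1] [cite: Miller2011LMS, Def. 1.1] -/
theorem bsdp_two_twist_2045b1_neg19 [NeZero (c2045b1.conductorNorm ℤ)]
    (Dt : ModularParametrizationData c2045b1 (c2045b1.conductorNorm ℤ)) (hopt : Zhai2021.IsOptimalDatum c2045b1 Dt)
    (hL : ∃ x : ℚ, IsLAlg c2045b1 x ∧ x ≠ 0 ∧ padicValRat 2 x = 0)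
    {c : VariableChange ℚ} (hc : c • c2045b1.quadraticTwist ((-19 : ℤ) : ℚ) = W) : BSDp W 2 :=
  haveI : Fact (Nat.Prime 19) := ⟨by norm_num⟩
  (bsdp_two_twist_2045b1_primeStar_of_forall_ne_zero W h11 h12 hMR' hmod hAU hCM hGZK Dt hopt hL (q := 19) (by norm_num) (by norm_num)
    forall_ne_zero_2045b1_19 (Or.inr (by norm_num)) (by decide) hc).2.2.2.2

include h11 h12 hMR' hmod hAU hCM hGZK in
/-- **`BSD(W, 2)` by print-transport for every globally minimal model of `2045b1^{(-23)}`** (`N = 1 081 805`; no root mod `23`, `decide`). CONDITIONAL;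
BSD is NOT proved. [cite: Zhai2016, Thm. 1.1] [cite: MazurRubin2010, Lemma 2.10] [cite: CreutzMiller2012, Thm. 1.1] [cite: Miller2011LMS, Def. 1.1] -/
theorem bsdp_two_twist_2045b1_neg23 [NeZero (c2045b1.conductorNorm ℤ)]
    (Dt : ModularParametrizationData c2045b1 (c2045b1.conductorNorm ℤ)) (hopt : Zhai2021.IsOptimalDatum c2045b1 Dt)
    (hL : ∃ x : ℚ, IsLAlg c2045b1 x ∧ x ≠ 0 ∧ padicValRat 2 x = 0)
    {c : VariableChange ℚ} (hc : c • c2045b1.quadraticTwist ((-23 : ℤ) : ℚ) = W) : BSDp W 2 :=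
  haveI : Fact (Nat.Prime 23) := ⟨by norm_num⟩
  (bsdp_two_twist_2045b1_primeStar_of_forall_ne_zero W h11 h12 hMR' hmod hAU hCM hGZK Dt hopt hL (q := 23) (by norm_num) (by norm_num)
    forall_ne_zero_2045b1_23 (Or.inr (by norm_num)) (by decide) hc).2.2.2.2

include h11 h12 hMR' hmod hAU hCM hGZK in
/-- **`BSD(W, 2)` by print-transport for every globally minimal model of `2045b1^{(-31)}`** (`N = 1 965 245`; no root mod `31`, `decide`). CONDITIONAL;
BSD is NOT proved. [cite: Zhai2016, Thm. 1.1] [cite: MazurRubin2010, Lemma 2.10] [cite: CreutzMiller2012, Thm. 1.1] [cite: Miller2011LMS, Def. 1.1] -/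
theorem bsdp_two_twist_2045b1_neg31 [NeZero (c2045b1.conductorNorm ℤ)]
    (Dt : ModularParametrizationData c2045b1 (c2045b1.conductorNorm ℤ)) (hopt : Zhai2021.IsOptimalDatum c2045b1 Dt)
    (hL : ∃ x : ℚ, IsLAlg c2045b1 x ∧ x ≠ 0 ∧ padicValRat 2 x = 0)
    {c : VariableChange ℚ} (hc : c • c2045b1.quadraticTwist ((-31 : ℤ) : ℚ) = W) : BSDp W 2 :=
  haveI : Fact (Nat.Prime 31) := ⟨by norm_num⟩
  (bsdp_two_twist_2045b1_primeStar_of_forall_ne_zero W h11 h12 hMR' hmod hAU hCM hGZK Dt hopt hL (q := 31) (by norm_num) (by norm_num)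
    forall_ne_zero_2045b1_31 (Or.inr (by norm_num)) (by decide) hc).2.2.2.2

include h11 h12 hMR' hmod hAU hCM hGZK in
/-- **`BSD(W, 2)` by print-transport for every globally minimal model of `2045b1^{(-59)}`** (`N = 7 118 645`; no root mod `59`, `decide`). CONDITIONAL;
BSD is NOT proved. [cite: Zhai2016, Thm. 1.1] [cite: MazurRubin2010, Lemma 2.10] [cite: CreutzMiller2012, Thm. 1.1] [cite: Miller2011LMS, Def. 1.1] -/
theorem bsdp_two_twist_2045b1_neg59 [NeZero (c2045b1.conductorNorm ℤ)]
    (Dt : ModularParametrizationData c2045b1 (c2045b1.conductorNorm ℤ)) (hopt : Zhai2021.IsOptimalDatum c2045b1 Dt)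
    (hL : ∃ x : ℚ, IsLAlg c2045b1 x ∧ x ≠ 0 ∧ padicValRat 2 x = 0)
    {c : VariableChange ℚ} (hc : c • c2045b1.quadraticTwist ((-59 : ℤ) : ℚ) = W) : BSDp W 2 :=
  haveI : Fact (Nat.Prime 59) := ⟨by norm_num⟩
  (bsdp_two_twist_2045b1_primeStar_of_forall_ne_zero W h11 h12 hMR' hmod hAU hCM hGZK Dt hopt hL (q := 59) (by norm_num) (by norm_num)
    forall_ne_zero_2045b1_59 (Or.inr (by norm_num)) (by decide) hc).2.2.2.2

include h11 h12 hMR' hmod hAU hCM hGZK in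
/-- **`BSD(W, 2)` by print-transport for every globally minimal model of `2045b1^{(73)}`** (`N = 10 897 805`; no root mod `73`, `decide`). CONDITIONAL;
BSD is NOT proved. [cite: Zhai2016, Thm. 1.1] [cite: MazurRubin2010, Lemma 2.10] [cite: CreutzMiller2012, Thm. 1.1] [cite: Miller2011LMS, Def. 1.1] -/
theorem bsdp_two_twist_2045b1_73 [NeZero (c2045b1.conductorNorm ℤ)]
    (Dt : ModularParametrizationData c2045b1 (c2045b1.conductorNorm ℤ)) (hopt : Zhai2021.IsOptimalDatum c2045b1 Dt)
    (hL : ∃ x : ℚ, IsLAlg c2045b1 x ∧ x ≠ 0 ∧ padicValRat 2 x = 0)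
    {c : VariableChange ℚ} (hc : c • c2045b1.quadraticTwist ((73 : ℤ) : ℚ) = W) : BSDp W 2 :=
  haveI : Fact (Nat.Prime 73) := ⟨by norm_num⟩
  (bsdp_two_twist_2045b1_primeStar_of_forall_ne_zero W h11 h12 hMR' hmod hAU hCM hGZK Dt hopt hL (q := 73) (by norm_num) (by norm_num)
    forall_ne_zero_2045b1_73 (Or.inl (by norm_num)) (by decide) hc).2.2.2.2

end Members2045b1

end Summit.BirchSwinnertonDyer.BirchSwinnertonDyer.Theorems.AlignedTransportAtTwoTwistFamilyZhaiTransportMembers2045b1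

end
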